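import Summits.QuantumFields.BalabanUV.T4Continuum.Support.NE7HintOfDbarSU2
import Summits.QuantumFields.BalabanUV.T4Continuum.Support.NE7DbarChainM4
import HarnessLib

/-!
# NE7 (pub-balaban, rung (B)+1, d = 4, SU(2), L = 2): ROW NE7's END OF RECORD IN S2′'s CURRENCY WITH THE QUARTIC ℓ¹ MASS LINE — `hint_SU2_of_dbar_M4`

Cell `pub-balaban`, rung (B)+1 sub-cell t4, lineage `b2b-balaban-t4-ne7-p1` (CRUX PROVER NE7 #1 = OWNER of row NE7), generation 98; memo `t4/b2b-balaban-t4-ne7-p1-g98/ROAD-G98.md` §3.4.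

WHY.  `NE7HintOfDbarSU2.hint_SU2_of_dbar'` (p748379, the merged per-pair form) still carries the ℓ¹ mass line of the slice corrector with exponent 3, `Σ‖μ‖ ≤ m₁·M³·‖X‖_w²`,
inherited from `curlL1_gaugeDir_le_of_mass` which discards a power of `M`.  The scaling audit (memo §3.4: `Σ‖μ‖ ≍ c·(Mb)·M⁴·‖X‖_w²` for the S1 representative) shows the cubic line
needs `m₁ ≍ M` while the QUARTIC line `Σ‖μ‖ ≤ m₁·M⁴·‖X‖_w²` holds with k-free `m₁ ≍ c·α̂` — and the quartic line feeds the SAME `κ` (`x²M⁴ = (M²x)²`).  THIS FILE is the END with the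
quartic line, over `NE7DbarChainM4.hdecomp_body_of_dbar_M4`; everything else (gen 95's line, the four `α̂`-lines, the two ceiling lines, (AB′) with ANY unitary gauge, `hdbar`, the two
frame masses) is byte-identical to `hint_SU2_of_dbar'`.  THIS is row NE7's END of record in S2′'s currency.

HONEST FRAMING (page 1): composition and real arithmetic over landed kernel theorems; nothing of Bałaban's asserted; (AB′) and the numeric lines are hypotheses; NE7 NOT PROVED;
spine 0∕9; finite T⁴ rung (B)+1 — NOT infinite volume, NOT mass gap, NOT `BetaPertH`, NOT Clay.  Continuum YM on T⁴ ⇐ BetaPertH ∧ nine spine estimates (0/9 proved); BetaPertH ⇐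
(D1) ∧ (D4) ∧ (CAP+tail).

WHAT ([folklore]; 0 def, 0 sorry).  `hint_SU2_of_dbar_M4`.
-/

namespace Summit.QuantumFields.BalabanUV.T4Continuum.NE7HintOfDbarSU2M4

open scoped BigOperators Matrix Matrix.Norms.L2Operator Topology
open NormedSpace Finset Set Filter

open Literature.MathematicalPhysics.QuantumFieldTheory.Balaban1983to89
open B7Prop1Explicit B7Prop2Explicit B7Prop3Flat MatrixLog UnitaryModel MatrixNorms
open T4AveragingDeficitWall (Ad IsUnitaryCfg IsSkewDir SmallField vary curl curlSq dirSq dirL1)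
open T4AveragingDeficitWallBoundary (IsPeriodicCfg periodBox)
open AveragingDeficitPeriodicCounting (IsPeriodicDir)
open AveragingDeficitMultiLevelPrep (LevelSmall tower TangentIter cavgIter)
open BlockAverageVaryHolo (nbRad)
open NE3CovariantLineSumsError (Csup Csup_nonneg)
open ShellMeasureAverageProp4General (C1cov C1cov_pos)
open MinimalActionLevels (perWin)
open MinimalActionSandwich (IsMinimiser admissible)
open MinimalActionRate (sfClass)
open NE3HessForm (dAction)
open NE3SlicePoincareBudgetLine (CPLine)
open NE3TangentCovariantTower (dirIter QbarIter framePotW)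
open B7Eq92Concrete (vcov)
open NE3.PairLandauB8Avg (relPert)
open BlockAveragePushDirGauge (gaugeDir)
open NE3CornerSpikes (spikeW)
open NE3QbarIterCovLiftPrep (cruxC)
open NE3SmoothRightInverseW (rightInvW)
open NE3RightInverseSolveLetters (thetaLoc thetaLoc_nonneg)
open NE3RightInverseL2Letter (l2C)
open NE3HatInvCurlLetters (curl2C curl1C)
open NE3EnergyShapes (IsUnitarySite IsPeriodicSite)
open NE3EnergyWeightedShapes (energyNormW)
open NE3FrameFreeSliceW (frameFreeBlockLandauW)
open NE7HintOfSliceNormalisationSU2Dec (hint_SU2_of_decomposition)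
open B7Eq92Concrete (vcov dbavgCovIter)
open NE3.PairLandauB8Avg (relPert)
open NE7HintOfTopNormalisedSU2 (eps_lines_of_le)
open NE7DbarChainM4 (hdecomp_body_of_dbar_M4)

noncomputable section

variable {n : Type} [Fintype n] [DecidableEq n]

/-! ## §1 The END with the quartic mass line -/

/-- **ROW NE7's END OF RECORD OVER ROAD-Γ′ WITH S2′ — MERGED FORM, QUARTIC ℓ¹ MASS LINE** (`d = 4`, `L = 2`, SU(2)): gen 95's `hint_SU2_of_decomposition` with `hdecomp♭` REPLACED by
(AB′): per admissible pair `(U_s, U′)` (`U_s` tangent-critical, `u₀` a residual near-representative) ONE representative — a unitary gauge `u` (corner values free), a skew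
`(N·M)`-periodic `X` with `U′^{u} = U_s·e^{X}`, `sup‖X‖ ≤ b`, `M·b ≤ α̂`, `dbavgCovIter 2 U_s (relPert U_s X) (k+1) = 1` — carrying the two frame masses `Θ₂, Θ₁` and, for every
corner-trivial slice-correcting generator `μ` of its tangent residual, `dirSq (D μ) ≤ m₂M²‖X‖_w²`, `Σ‖μ‖² ≤ p₂M⁴‖X‖_w²`, `Σ‖μ‖ ≤ m₁·M⁴·‖X‖_w²` (QUARTIC); plus gen 95's line, four
`α̂`-lines and the two ceiling lines. [folklore] -/
theorem hint_SU2_of_dbar_M4 [Nonempty n] (hn : Fintype.card n = 2) :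
    ∃ ℓ : ℕ, 1 ≤ ℓ ∧ ∃ ε₀ : ℝ, 0 < ε₀ ∧ ∀ ε : ℝ, 0 < ε → ε ≤ ε₀ → ∃ β₀ : ℝ, 0 < β₀ ∧ ∀ β : ℝ, 0 < β → β ≤ β₀ →
    ∀ (N : ℕ) [NeZero N] (αh νh κh m₂ p₂ m₁ Θ₂ Θ₁ : ℝ), 1 ≤ N →
    -- gen 95's k-free strict line (F327)
    2 * κh < ((((1 / 2 - νh ^ 2) / (2 * (1 + (CPLine 4 2 2 (1 / 10 ^ 17) (1 / 10 ^ 53) + 1))) - νh ^ 2) / 2 - 576 * ((4 : ℕ) : ℝ) * (αh ^ 2 * Real.exp (2 * αh))) / (Fintype.card n : ℝ) - 28 * ((4 : ℕ) : ℝ) * (ε + 7 * αh ^ 2)) →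
    -- four k-free lines on `α̂`
    8 * (131072 * (((4 : ℕ) : ℝ) + 1) ^ 2) * αh ≤ 1 / 10 → 4 * αh ≤ c3 4 2 →
    16 * (C1cov 4 * ((2 : ℕ) : ℝ) ^ 2 * Real.sqrt (((4 : ℕ) : ℝ) * (2 * (2 * ((2 : ℕ) : ℝ)) + 1) ^ 4)) * αh ≤ Real.sqrt (((2 : ℕ) : ℝ) ^ 2 / ((2 : ℕ) : ℝ) ^ 4) →
    44 * (((4 : ℕ) : ℝ) * ((2 : ℕ) : ℝ) * αh) ≤ 1 →
    -- the masses are non-negative and meet the two ceiling lines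
    0 ≤ m₂ → 0 ≤ p₂ → 0 ≤ m₁ → 0 ≤ Θ₂ → 0 ≤ Θ₁ →
    2 * Real.sqrt (((Fintype.card (T4AveragingDeficitWall.Plane 4) : ℝ) + ((4 : ℕ) : ℝ))
            * (3 * Θ₂ + (12288 * ((((4 : ℕ) : ℝ)) ^ 3 * ((2 : ℕ) : ℝ) ^ 5) * 2 + 3072 * ((((4 : ℕ) : ℝ)) * ((2 : ℕ) : ℝ)) * (C1cov 4 * ((2 : ℕ) : ℝ) ^ 2 * Real.sqrt (((4 : ℕ) : ℝ) * (2 * (2 * ((2 : ℕ) : ℝ)) + 1) ^ 4)) ^ 2 * 1)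
              * αh ^ 2))
          + Real.sqrt ((l2C 4 2 / (1 - thetaLoc 4 2 * ε) ^ 2 + curl2C 4 2 / (1 - thetaLoc 4 2 * ε) ^ 2)
              * (1024 * (C1cov 4 * ((2 : ℕ) : ℝ) ^ 2 * Real.sqrt (((4 : ℕ) : ℝ) * (2 * (2 * ((2 : ℕ) : ℝ)) + 1) ^ 4)) ^ 2 * (((2 : ℕ) : ℝ) ^ 4 / ((2 : ℕ) : ℝ) ^ 4))) * αh
          + Real.sqrt (4 * ε ^ 2 * (Fintype.card (T4AveragingDeficitWall.Plane 4)) * p₂ + m₂) ≤ νh →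
    2 * (Fintype.card (T4AveragingDeficitWall.Plane 4) : ℝ)
            * (Θ₁ + (16 * ((((4 : ℕ) : ℝ)) * ((2 : ℕ) : ℝ)) * (6 * 2 + 2 * (4 / 3)) + 64 * (C1cov 4 * ((2 : ℕ) : ℝ) ^ 2 * (((4 : ℕ) : ℝ) * (2 * (2 * ((2 : ℕ) : ℝ)) + 1) ^ 4)) * (4 / 3))) * ε ^ 2
          + (curl1C 4 2 / (1 - thetaLoc 4 2 * ε)) * ε * (64 * (C1cov 4 * ((2 : ℕ) : ℝ) ^ 2 * (((4 : ℕ) : ℝ) * (2 * (2 * ((2 : ℕ) : ℝ)) + 1) ^ 4)) * (((2 : ℕ) : ℝ) ^ 4 / ((2 : ℕ) : ℝ) ^ 2))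
          + 2 * (Fintype.card (T4AveragingDeficitWall.Plane 4)) * ε ^ 2 * m₁ ≤ κh →
    -- (AB′) PER PAIR, ONE REPRESENTATIVE WITH TRIVIAL TOP DOUBLE-BAR FIELD (ANY unitary gauge) CARRYING THE FRAME MASSES AND THE SLICE MASSES (ROAD-Γ′ S1 + S2′ + masses)
    (∀ D : Site 4 → Fin 4 → (Matrix n n ℂ)ˣ, IsUnitaryCfg D → IsPeriodicCfg D (N : ℤ) → SmallField D (4 * (Real.exp β - 1)) → ∀ (k : ℕ), ∀ Us ∈ admissible (sfClass 4 2 N ε) 2 (k + 1) D, SmallField Us ((1 / ((2 : ℕ) : ℝ) ^ 2 * ε / 2) / (((2 : ℕ) : ℝ) ^ (k + 1)) ^ 2) → (∀ φ : Site 4 → Fin 4 → Matrix n n ℂ, IsSkewDir φ → IsPeriodicDir φ ((N * 2 ^ (k + 1) : ℕ) : ℤ) → TangentIter 2 k Us φ → dAction Us φ (perWin 4 (N * 2 ^ (k + 1))) = 0) → ∀ U' ∈ admissible (sfClass 4 2 N ε) 2 (k + 1) D,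
      ∀ u₀ : Site 4 → (Matrix n n ℂ)ˣ, IsUnitarySite u₀ → IsPeriodicSite u₀ ((N * 2 ^ (k + 1) : ℕ) : ℤ) → (∀ z : Site 4, u₀ (((2 ^ (k + 1) : ℕ) : ℤ) • z) = 1) →
        (∀ (x : Site 4) (μ : Fin 4), ‖(((Us x μ)⁻¹ * gaugeAct u₀ U' x μ : (Matrix n n ℂ)ˣ) : Matrix n n ℂ) - 1‖
          ≤ 10000000000000000000000000000000000 * (2 : ℝ) ^ (k + 1) * (ε / (((2 : ℕ) : ℝ) ^ (k + 1)) ^ 2)) →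
      ∃ (u : Site 4 → (Matrix n n ℂ)ˣ) (X : Site 4 → Fin 4 → Matrix n n ℂ) (b : ℝ),
        IsUnitarySite u ∧ IsSkewDir X ∧ IsPeriodicDir X ((N * 2 ^ (k + 1) : ℕ) : ℤ) ∧ 0 ≤ b ∧
        (∀ x μ, ‖X x μ‖ ≤ b) ∧ gaugeAct u U' = vary Us X 1 ∧ dbavgCovIter 2 Us (relPert Us X) (k + 1) = 1 ∧ ((2 : ℕ) : ℝ) ^ (k + 1) * b ≤ αh ∧
      (∑ z ∈ periodBox (d := 4) N, ‖mlog ((vcov 2 Us (relPert Us X) (k + 1) z : (Matrix n n ℂ)ˣ) : Matrix n n ℂ)‖ ^ 2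
          ≤ Θ₂ * (((2 : ℕ) : ℝ) ^ (k + 1)) ^ 2 * energyNormW 2 (k + 1) Us X (periodBox (d := 4) (N * 2 ^ (k + 1))) ^ 2
        ∧ ∑ z ∈ periodBox (d := 4) N, ‖mlog ((vcov 2 Us (relPert Us X) (k + 1) z : (Matrix n n ℂ)ˣ) : Matrix n n ℂ)‖
          ≤ Θ₁ * (((2 : ℕ) : ℝ) ^ (k + 1)) ^ 2 * energyNormW 2 (k + 1) Us X (periodBox (d := 4) (N * 2 ^ (k + 1))) ^ 2) ∧
      ∀ (hWu : IsUnitaryCfg Us) (hWx : SmallField Us (ε / (((2 : ℕ) : ℝ) ^ (k + 1)) ^ 2)) (hx0 : 0 ≤ ε / (((2 : ℕ) : ℝ) ^ (k + 1)) ^ 2)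
        (hsm0 : LevelSmall 4 2 k (ε / (((2 : ℕ) : ℝ) ^ (k + 1)) ^ 2)) (hθ0 : cruxC 4 2 * ((((2 : ℕ) : ℝ) ^ (k + 1)) ^ 2 * (ε / (((2 : ℕ) : ℝ) ^ (k + 1)) ^ 2)) < 1)
        (hYs : IsSkewDir (dirIter 2 (k + 1) Us (fun y ν => X y ν - gaugeDir Us (spikeW (2 ^ (k + 1)) (framePotW 2 (k + 1) Us X)) y ν)))
        (mu : Site 4 → Matrix n n ℂ), (∀ y, mu y ∈ skewAdjoint (Matrix n n ℂ)) →
        (∀ (y : Site 4) (i : Fin 4), mu (y + ((N * 2 ^ (k + 1) : ℕ) : ℤ) • e i) = mu y) → (∀ w : Site 4, mu ((((2 : ℕ) : ℤ) ^ (k + 1)) • w) = 0) →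
        (fun y ν => (X y ν - (gaugeDir Us (spikeW (2 ^ (k + 1)) (framePotW 2 (k + 1) Us X)) + rightInvW (le_refl 2) k hWu hx0 hsm0 hWx N hθ0 hYs) y ν) + gaugeDir Us mu y ν)
          ∈ frameFreeBlockLandauW (d := 4) (n := n) 2 N (k + 1) Us →
        dirSq (gaugeDir Us mu) (periodBox (d := 4) (N * 2 ^ (k + 1))) ≤ m₂ * (((2 : ℕ) : ℝ) ^ (k + 1)) ^ 2 * energyNormW 2 (k + 1) Us X (periodBox (d := 4) (N * 2 ^ (k + 1))) ^ 2
        ∧ ∑ z ∈ periodBox (d := 4) (N * 2 ^ (k + 1)), ‖mu z‖ ^ 2 ≤ p₂ * (((2 : ℕ) : ℝ) ^ (k + 1)) ^ 4 * energyNormW 2 (k + 1) Us X (periodBox (d := 4) (N * 2 ^ (k + 1))) ^ 2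
        ∧ ∑ z ∈ periodBox (d := 4) (N * 2 ^ (k + 1)), ‖mu z‖ ≤ m₁ * (((2 : ℕ) : ℝ) ^ (k + 1)) ^ 4 * energyNormW 2 (k + 1) Us X (periodBox (d := 4) (N * 2 ^ (k + 1))) ^ 2) →
    ∃ δV : ℝ, 0 < δV ∧
      ∀ V ∈ {V : Site 4 → Fin 4 → (Matrix n n ℂ)ˣ | IsUnitaryCfg V ∧ IsPeriodicCfg V (N : ℤ) ∧ SmallField V δV},
      ∀ k : ℕ, ∃ U : Site 4 → Fin 4 → (Matrix n n ℂ)ˣ, IsMinimiser 4 (sfClass 4 2 N ε) 2 N k V U ∧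
        ∃ a : ℝ, 0 ≤ a ∧ a < ε / (((2 : ℕ) : ℝ) ^ k) ^ 2 ∧ SmallField U a := by
  obtain ⟨ℓ, hℓ1, ε₀, hε₀, H⟩ := hint_SU2_of_decomposition (n := n) hn
  set ε₁ : ℝ := min (1 / 10 ^ 11) (min (1 / (2 * (thetaLoc 4 2 + 1))) (min (1 / (12 * C0 4)) (min (c2' 4 2 / 16)
      ((3 / 32) / (16 * (((4 : ℕ) : ℝ) + 1) * (((4 : ℕ) : ℝ) + 4) * ((2 : ℕ) : ℝ) ^ 2 * Csup 4 2 * (((4 : ℕ) : ℝ) * (2 * ((nbRad 4 2 : ℕ) : ℝ) + 1) ^ 4) + 1))))) with hε₁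
  have hε₁0 : 0 < ε₁ := by
    have hθ0 : 0 ≤ thetaLoc 4 2 := thetaLoc_nonneg 4 2
    have hC0 : 0 < C0 4 := C0_pos 4
    have hc2 : 0 < c2' 4 2 := c2'_pos 4 2 (by norm_num)
    have hCS : 0 ≤ 16 * (((4 : ℕ) : ℝ) + 1) * (((4 : ℕ) : ℝ) + 4) * ((2 : ℕ) : ℝ) ^ 2 * Csup 4 2 * (((4 : ℕ) : ℝ) * (2 * ((nbRad 4 2 : ℕ) : ℝ) + 1) ^ 4) := by
      have := Csup_nonneg 4 2; positivity
    rw [hε₁]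
    refine lt_min (by norm_num) (lt_min (by positivity) (lt_min (by positivity) (lt_min (by positivity) (by positivity))))
  refine ⟨ℓ, hℓ1, min ε₀ ε₁, lt_min hε₀ hε₁0, fun ε hε hεle => ?_⟩
  obtain ⟨β₀, hβ₀, H2⟩ := H ε hε (hεle.trans (min_le_left _ _))
  refine ⟨β₀, hβ₀, fun β hβ hβle N _ αh νh κh m₂ p₂ m₁ Θ₂ Θ₁ hN hline hαh1 hαh2 hαh3 hαh4 hm₂ hp₂ hm₁ hΘ₂0 hΘ₁0 hνh hκh hAB => ?_⟩
  obtain ⟨hε11, hεθ, hεC0, hεc2, hεS1⟩ := eps_lines_of_le hε (hεle.trans (min_le_right _ _))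
  refine H2 β hβ hβle N αh νh κh hN hline ?_
  intro D hD hDP hDS k Us hUs hUsS hcrit U' hU' u₀ hu₀U hu₀P hu₀pin hu₀err
  -- class data of the pair
  have hUs' : IsUnitaryCfg Us ∧ IsPeriodicCfg Us ((N * 2 ^ (k + 1) : ℕ) : ℤ) ∧ SmallField Us (ε / (((2 : ℕ) : ℝ) ^ (k + 1)) ^ 2) := hUs.1
  -- (AB′): the representative together with its masses
  obtain ⟨u, X, b, hu, hXs, hXP, hb, hX, hrep, hdbar, hbα, ⟨hΘ₂, hΘ₁⟩, hμ0⟩ := hAB D hD hDP hDS k Us hUs hUsS hcrit U' hU' u₀ hu₀U hu₀P hu₀pin hu₀err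
  have hμ := hμ0 hUs'.1 hUs'.2.2
  exact hdecomp_body_of_dbar_M4 (N := N) hN k hε hε11 hεθ hεC0 hεc2 hεS1 hUs'.1 hUs'.2.1 hUs'.2.2 hαh1 hαh2 hαh3 hαh4
    hu hXs hXP hb hX hrep hdbar hbα hΘ₂0 hΘ₂ hΘ₁0 hΘ₁ hm₂ hp₂ hm₁ (fun hx0 hsm0 hθ0 hYs mu h1 h2 h3 h4 => hμ hx0 hsm0 hθ0 hYs mu h1 h2 h3 h4) hνh hκh

end

end Summit.QuantumFields.BalabanUV.T4Continuum.NE7HintOfDbarSU2M4
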